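import Mathlib
import Summits.Ventures.LatticeQCDFlow.TrivializingMaps.GradedSupBounds
import HarnessLib

/-!
# Mixed second link derivatives of the Casimir-graded series on `SU(n)^E`

HONEST FRAMING: exact (Metropolis-corrected) sampling algorithms for lattice gauge theory; figures
of merit are autocorrelation/cost numbers at stated couplings and volumes; no continuum-physics claim.
Statements about the explicit Casimir-graded solution `gradedSk B k = S̃^{(k)}` of Lüscher's recursion
(4.12)–(4.15) [Luscher2010Trivializing, M. Lüscher, CMP 293 (2010) 899–919, §4.3–§4.5] for the SU(n)
Wilson plaquette action on a FINITE periodic lattice `(ℤ/L)^d`; venture-side (`Summits/Ventures/…`),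
never `Literature/`.

WHY (THEORY-1.md §26, THEOREM L = `FlowLightCone.lean`): the light cone of the flow-defined map needs a
volume-uniform sup-LIPSCHITZ modulus `K_Z` of the generator `U ↦ Z_t(U)_e = -∑ₐ ∂^a_e S̃_t(U) T^a` on
`SU(n)^E`. Its infinitesimal form is a bound on the MIXED second link derivatives
`∂^b_{e'} ∂^a_e S̃^{(k)}` — the Hessian of the flow action across two (possibly different) links. The tree
(`GradedSupBounds`, lean-2) bounds the DIAGONAL ones `∂^a_e∂^a_e S̃^{(k)}` (what the series summation
needs); this file records that the same masses bound the mixed ones, with the same constants: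

* `Gen.linkDeriv_linkDeriv_term_mixed`: `∂^b_{e'}∂^a_e termF(z,x,y) = termF(z,x,T_b^{σ,e'} T_a^{σ,e} y)`;
* `Gen.abs_linkDeriv_linkDeriv_term_mixed_le`: `|∂^b_{e'}∂^a_e termᵢ(ιU)| ≤ √((mᵢ)_{e'}) √((mᵢ)_e) νᵢ`
  (each generator preserves the joint Casimir space and costs the square root of its link's mode);
* `Gen.abs_linkDeriv_linkDeriv_func_mixed_le`: `|∂^b_{e'}∂^a_e G.func(ιU)| ≤ (max_i wtᵢ(e')) · N_G(e)`;
* `abs_linkDeriv_linkDeriv_gradedSk_mixed_le`: **`|∂^b_{e'} ∂^a_e S̃^{(k)}(ιU)| ≤ (k+1) τ_* · N₀ θ₁^k`**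
  for ALL links `e, e'`, directions `a, b`, fields `U ∈ SU(n)^E`, volumes `L`, bases `B`, `n ≠ 0`;
* `abs_linkDeriv_linkDeriv_truncFlowAction_mixed_le`: for the order-`N` truncated flow action
  `S̃^{[N]}_t = ∑_{k≤N} t^k S̃^{(k)}` (Lüscher §4.5(c)),
  `|∂^b_{e'} ∂^a_e S̃^{[N]}_t(ιU)| ≤ ∑_{k≤N} |t|^k (k+1) τ_* N₀ θ₁^k`.

All constants depend on `d, n, B` (and `N, t`) only — NOT on the volume `L`. WHAT THIS DOES NOT DO: the
passage from this Hessian bound to the Lipschitz modulus `K_Z` of THEOREM L needs a mean-value inequality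
ALONG `SU(n)` (a path `s ↦ exp(sY)U_e` with `‖Y‖` controlled by `‖U_e - U'_e‖_F`), which is not in the
tree; THEORY-1.md §26 names the combination `TruncatedGeneratorLipschitz` (open input). Nothing here is
a claim about the exact (untruncated) trivializing map.
Authored by the pub-lqcd theory-1 seat (cell lqcd-flow, FANOUT row 28, GEN-17); proofs follow lean-2's
diagonal ones in `GradedSupBounds` §4 line by line. Tags: [ours] = venture work.
-/

noncomputable section

namespace Summit.Ventures.LatticeQCDFlow.TrivializingMaps

open scoped ComplexConjugate Matrix Matrix.Norms.Frobenius InnerProductSpace ContDiff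
open Literature.MathematicalPhysics.QuantumFieldTheory
open Literature.MathematicalPhysics.QuantumFieldTheory.Luscher2010
open SlotRepresentation SlotCasimir SlotHilbert JointGrading CasimirGrading PlaquetteData SlotTensor
  TensorShift RankOne Vertex

namespace GradedSeries

open Finset

variable {d L n : ℕ} [NeZero L]

/-! ## §1. One datum, one sum system -/

section Mixed

variable {B : SuBasis n}
variable {σ : Type} [Fintype σ] [DecidableEq σ] (G : Gen (d := d) (L := L) B σ)

omit [NeZero L] in
/-- **Mixed link derivatives of a datum**: `∂^b_{e'} ∂^a_e termF(z,x,y) = termF(z,x,T_b^{σ,e'}(T_a^{σ,e} y))`,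
identically on the ambient space. [ours] -/
theorem Gen.linkDeriv_linkDeriv_term_mixed (i : G.I) (e e' : Edge d L) (a b : B.ι) (W : AmbConfig d L n) :
    linkDeriv e' (B.T b) (linkDeriv e (B.T a) (G.term i)) W =
      termF (G.lnk i) (G.pol i) (G.z i) (G.x i)
        (genCLM (G.lnk i) (G.pol i) e' (B.T b) (genCLM (G.lnk i) (G.pol i) e (B.T a) (G.y i))) W := by
  have h1 : linkDeriv e (B.T a) (G.term i) =
      fun W' => -termF (G.lnk i) (G.pol i) (G.z i) (G.x i) (genCLM (G.lnk i) (G.pol i) e (B.T a) (G.y i)) W' :=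
    funext fun W' => linkDeriv_termF_skew (G.lnk i) (G.pol i) (G.z i) (G.x i) (G.y i) e (skew_T B a) W'
  rw [h1, linkDeriv_neg', linkDeriv_termF_skew _ _ _ _ _ e' (skew_T B b), neg_neg]

omit [NeZero L] in
/-- **A mixed second derivative costs both weights**: `|∂^b_{e'}∂^a_e termᵢ(ιU)| ≤ √((mᵢ)_{e'}) √((mᵢ)_e) νᵢ`
(both generators preserve the joint Casimir space, `genCLM_mem_jointSpace`, and cost `√((mᵢ)_e)` resp.
`√((mᵢ)_{e'})` on it, `norm_genCLM_jointProj_le`). [ours] -/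
theorem Gen.abs_linkDeriv_linkDeriv_term_mixed_le (i : G.I) (e e' : Edge d L) (a b : B.ι)
    (U : GaugeConfig d L (Matrix.specialUnitaryGroup (Fin n) ℂ)) :
    |linkDeriv e' (B.T b) (linkDeriv e (B.T a) (G.term i)) (WilsonFlow.coeConfig U)|
      ≤ G.wt i e' * G.wt i e * G.nu i := by
  classical
  rw [G.linkDeriv_linkDeriv_term_mixed]
  set C := casimirFamily (G.lnk i) (G.pol i) B with hC
  set g := genCLM (G.lnk i) (G.pol i) e (B.T a) with hg
  set g' := genCLM (G.lnk i) (G.pol i) e' (B.T b) with hg'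
  have hy : G.y i ∈ jointSpace C (G.m i) := jointProj_apply_mem C (G.m i) (G.v i)
  have hgy : g (G.y i) ∈ jointSpace C (G.m i) := genCLM_mem_jointSpace _ _ B (G.m i) e (B.mem a) hy
  have hcost : ∀ w ∈ jointSpace C (G.m i), ‖g w‖ ≤ Real.sqrt ((G.m i) e : ℂ).re * ‖w‖ := by
    intro w hw
    have h := norm_genCLM_jointProj_le (G.lnk i) (G.pol i) B (G.m i) e a w
    rwa [jointProj_eq_self_of_mem (G.m i) hw] at h
  have hcost' : ∀ w ∈ jointSpace C (G.m i), ‖g' w‖ ≤ Real.sqrt ((G.m i) e' : ℂ).re * ‖w‖ := by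
    intro w hw
    have h := norm_genCLM_jointProj_le (G.lnk i) (G.pol i) B (G.m i) e' b w
    rwa [jointProj_eq_self_of_mem (G.m i) hw] at h
  have hgg : ‖g' (g (G.y i))‖ ≤ G.wt i e' * (G.wt i e * ‖G.y i‖) := by
    calc ‖g' (g (G.y i))‖ ≤ Real.sqrt ((G.m i) e' : ℂ).re * ‖g (G.y i)‖ := hcost' _ hgy
      _ ≤ Real.sqrt ((G.m i) e' : ℂ).re * (Real.sqrt ((G.m i) e : ℂ).re * ‖G.y i‖) :=
          mul_le_mul_of_nonneg_left (hcost _ hy) (Real.sqrt_nonneg _)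
      _ = G.wt i e' * (G.wt i e * ‖G.y i‖) := by unfold Gen.wt; rfl
  refine (abs_termF_coeConfig_le (G.lnk i) (G.pol i) (G.z i) (G.x i) _ U).trans ?_
  unfold Gen.nu
  calc ‖G.z i‖ * ‖G.x i‖ * ‖g' (g (G.y i))‖
      ≤ ‖G.z i‖ * ‖G.x i‖ * (G.wt i e' * (G.wt i e * ‖G.y i‖)) :=
        mul_le_mul_of_nonneg_left hgg (by positivity)
    _ = G.wt i e' * G.wt i e * (‖G.z i‖ * (‖G.x i‖ * ‖G.y i‖)) := by ring

/-- `∂^b_{e'}∂^a_e G.func = ∑ᵢ ∂^b_{e'}∂^a_e termᵢ` everywhere. [ours] -/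
theorem Gen.linkDeriv_linkDeriv_func_mixed (e e' : Edge d L) (a b : B.ι) (W : AmbConfig d L n) :
    linkDeriv e' (B.T b) (linkDeriv e (B.T a) G.func) W =
      ∑ i, linkDeriv e' (B.T b) (linkDeriv e (B.T a) (G.term i)) W := by
  have h1 : linkDeriv e (B.T a) G.func = fun W' => ∑ i ∈ Finset.univ, linkDeriv e (B.T a) (G.term i) W' :=
    funext fun W' => G.linkDeriv_func e a W'
  rw [h1]
  have h := congrFun (linkDeriv_finset_sum e' (B.T b) Finset.univ (fun i => linkDeriv e (B.T a) (G.term i))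
    fun i _ => contDiff_linkDeriv (G.contDiff_term i) e (B.T a)) W
  exact h

/-- **Mixed second derivatives are dominated by (max weight at `e'`) × (mass at `e`)**: if dead data carry no
coefficient and all weights at `e'` are `≤ M`, then `|∂^b_{e'}∂^a_e G.func(ιU)| ≤ M · N_G(e)`. [ours] -/
theorem Gen.abs_linkDeriv_linkDeriv_func_mixed_le (hz : ∀ i, G.cm i = 0 → G.z i = 0) {e e' : Edge d L}
    {M : ℝ} (hM : ∀ i, G.wt i e' ≤ M) (a b : B.ι)
    (U : GaugeConfig d L (Matrix.specialUnitaryGroup (Fin n) ℂ)) :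
    |linkDeriv e' (B.T b) (linkDeriv e (B.T a) G.func) (WilsonFlow.coeConfig U)| ≤ M * G.mass e := by
  rw [G.linkDeriv_linkDeriv_func_mixed]
  refine (Finset.abs_sum_le_sum_abs _ _).trans ?_
  have h1 : ∑ i, |linkDeriv e' (B.T b) (linkDeriv e (B.T a) (G.term i)) (WilsonFlow.coeConfig U)|
      ≤ ∑ i, M * (G.wt i e * G.nu i) := by
    refine Finset.sum_le_sum fun i _ => (G.abs_linkDeriv_linkDeriv_term_mixed_le i e e' a b U).trans ?_
    rw [mul_assoc]
    exact mul_le_mul_of_nonneg_right (hM i) (mul_nonneg (G.wt_nonneg i e) (G.nu_nonneg i))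
  refine h1.trans (le_of_eq ?_)
  rw [← Finset.mul_sum]
  congr 1
  unfold Gen.mass Gen.live
  rw [Finset.sum_filter_of_ne]
  intro i _ hi hc
  apply hi
  have : G.nu i = 0 := by unfold Gen.nu; rw [hz i hc, norm_zero, zero_mul]
  rw [this, mul_zero]

end Mixed

/-! ## §2. The graded series and the truncated flow action -/

variable (B : SuBasis n)

/-- **Mixed second link derivatives of the graded series on `SU(n)^E`** (the link Hessian of `S̃^{(k)}`):
`|∂^b_{e'} ∂^a_e S̃^{(k)}(ιU)| ≤ (k+1) τ_* · N₀ θ₁^k` for all `e, e', a, b, U`; constants depend on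
`d, n, B` only. [ours] -/
theorem abs_linkDeriv_linkDeriv_gradedSk_mixed_le (hn : n ≠ 0) (k : ℕ)
    (U : GaugeConfig d L (Matrix.specialUnitaryGroup (Fin n) ℂ)) (e e' : Edge d L) (a b : B.ι) :
    |linkDeriv e' (B.T b) (linkDeriv e (B.T a) (gradedSk (d := d) (L := L) B k)) (WilsonFlow.coeConfig U)|
      ≤ ((k : ℝ) + 1) * tauStar B * (N0 d n * theta1 d n B ^ k) := by
  refine ((pack (d := d) (L := L) B k).G.abs_linkDeriv_linkDeriv_func_mixed_le (pack_z_eq_zero B k)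
    (fun i => wt_pack_le B k i e') a b U).trans ?_
  exact mul_le_mul_of_nonneg_left (mass_pack_le B hn k e)
    (mul_nonneg (by positivity) (tauStar_nonneg B))

/-- `∂^b_{e'}∂^a_e` of the truncated flow action is the truncated sum of the `∂^b_{e'}∂^a_e S̃^{(k)}`.
[folklore] -/
theorem linkDeriv_linkDeriv_truncFlowAction_gradedSk (t : ℝ) (N : ℕ) (e e' : Edge d L) (a b : B.ι)
    (W : AmbConfig d L n) :
    linkDeriv e' (B.T b) (linkDeriv e (B.T a) (truncFlowAction (gradedSk (d := d) (L := L) B) t N)) W =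
      ∑ k ∈ Finset.range (N + 1),
        t ^ k * linkDeriv e' (B.T b) (linkDeriv e (B.T a) (gradedSk (d := d) (L := L) B k)) W := by
  have h1 : linkDeriv e (B.T a) (truncFlowAction (gradedSk (d := d) (L := L) B) t N) =
      fun W' => ∑ k ∈ Finset.range (N + 1),
        t ^ k * linkDeriv e (B.T a) (gradedSk (d := d) (L := L) B k) W' := by
    have h := linkDeriv_finset_sum e (B.T a) (Finset.range (N + 1))
      (fun k W' => t ^ k * gradedSk (d := d) (L := L) B k W') (fun k _ => contDiff_const.mul (contDiff_gradedSk B k))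
    funext W'
    calc linkDeriv e (B.T a) (truncFlowAction (gradedSk (d := d) (L := L) B) t N) W'
        = ∑ k ∈ Finset.range (N + 1), linkDeriv e (B.T a) (fun W => t ^ k * gradedSk (d := d) (L := L) B k W) W' :=
          congrFun h W'
      _ = ∑ k ∈ Finset.range (N + 1), t ^ k * linkDeriv e (B.T a) (gradedSk (d := d) (L := L) B k) W' :=
          Finset.sum_congr rfl fun k _ => linkDeriv_const_mul' e (B.T a) (t ^ k) _ W'
  rw [h1]
  have h2 := linkDeriv_finset_sum e' (B.T b) (Finset.range (N + 1))
    (fun k W' => t ^ k * linkDeriv e (B.T a) (gradedSk (d := d) (L := L) B k) W')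
    (fun k _ => contDiff_const.mul (contDiff_linkDeriv (contDiff_gradedSk B k) e (B.T a)))
  calc linkDeriv e' (B.T b)
        (fun W' => ∑ k ∈ Finset.range (N + 1), t ^ k * linkDeriv e (B.T a) (gradedSk (d := d) (L := L) B k) W') W
      = ∑ k ∈ Finset.range (N + 1),
          linkDeriv e' (B.T b) (fun W' => t ^ k * linkDeriv e (B.T a) (gradedSk (d := d) (L := L) B k) W') W :=
        congrFun h2 W
    _ = ∑ k ∈ Finset.range (N + 1),
          t ^ k * linkDeriv e' (B.T b) (linkDeriv e (B.T a) (gradedSk (d := d) (L := L) B k)) W :=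
        Finset.sum_congr rfl fun k _ => linkDeriv_const_mul' e' (B.T b) (t ^ k) _ W

/-- **Link Hessian of the order-`N` truncated flow action on `SU(n)^E`**:
`|∂^b_{e'} ∂^a_e S̃^{[N]}_t(ιU)| ≤ ∑_{k≤N} |t|^k (k+1) τ_* N₀ θ₁^k`, every volume `L`. [ours; cf.
Luscher2010Trivializing §4.5(b),(c)] -/
theorem abs_linkDeriv_linkDeriv_truncFlowAction_mixed_le (hn : n ≠ 0) (t : ℝ) (N : ℕ)
    (U : GaugeConfig d L (Matrix.specialUnitaryGroup (Fin n) ℂ)) (e e' : Edge d L) (a b : B.ι) :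
    |linkDeriv e' (B.T b) (linkDeriv e (B.T a) (truncFlowAction (gradedSk (d := d) (L := L) B) t N))
        (WilsonFlow.coeConfig U)|
      ≤ ∑ k ∈ Finset.range (N + 1),
          |t| ^ k * (((k : ℝ) + 1) * tauStar B * (N0 d n * theta1 d n B ^ k)) := by
  rw [linkDeriv_linkDeriv_truncFlowAction_gradedSk]
  refine (Finset.abs_sum_le_sum_abs _ _).trans (Finset.sum_le_sum fun k _ => ?_)
  rw [abs_mul, abs_pow]
  exact mul_le_mul_of_nonneg_left (abs_linkDeriv_linkDeriv_gradedSk_mixed_le B hn k U e e' a b)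
    (pow_nonneg (abs_nonneg t) _)

end GradedSeries

end Summit.Ventures.LatticeQCDFlow.TrivializingMaps

end
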